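import Summits.Ventures.HodgeRepro2.T5HeckeAdjointHermitian
import Summits.Ventures.HodgeRepro2.T5HeckeGelfandTrick

/-!
# The Hecke operators `T_g` are self-adjoint for an invariant hermitian form when `K g⁻¹ K = K g K`

Kernel annex of the Tier-5 record (blind lane).  `T5HeckeAdjointHermitian` records
`B(T_g v, w) = B(v, T_{g⁻¹} w)` for a `G`-invariant hermitian form `B` on a unitary `π` and
`v, w ∈ π^K` (unimodularity in the counting form `hU`).  Under Gelfand's double-coset condition
`g⁻¹ ∈ K g K` (`T5HeckeGelfandTrick`) one has `T_{g⁻¹} = T_g`, so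

* `apply_heckeSMul_doubleCosetOp_self` — `B(T_g v, w) = B(v, T_g w)`: every `T_g` is
  **self-adjoint** on `π^K`;
* `apply_heckeSMul_eq_apply_heckeSMul_conjOp` — for every `T ∈ H(G, K)`:
  `B(T v, w) = B(v, T̄ w)` (`T̄ = conjOp T`, the coefficientwise conjugate), since
  `T^* = (T̄)^∨ = T̄` when `transposeOp` is the identity (the commutative case of Gelfand's trick);
* `apply_heckeSMul_eq_apply_heckeSMul_of_real` — for `T` with real coefficients (`conjOp T = T`):
  `B(T v, w) = B(v, T w)`.

This is the classical «the Hecke operators are self-adjoint for the Petersson product».  What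
stays prose: the double-coset condition for the specific `K` (Cartan decomposition + `-1` in the
relative Weyl group), the unimodularity of the specific group, the printed theorems.
-/

namespace Summit.Ventures.HodgeRepro2.T5HeckeSelfAdjoint

open T5HeckePermutationModule T5HeckeTranspose T5HeckeStar T5HeckeAdjointHermitian
  T5HeckeGelfandTrick LevelPositivity

variable {G : Type*} [Group G] {k : Type*} [Field k] [StarRing k]
  {V : Type*} [AddCommGroup V] [Module k V] {ρ : Representation k G V} {K : Subgroup G}

omit [StarRing k] in
/-- `T_{g⁻¹} = T_g` under the double-coset condition `g⁻¹ ∈ K g K`. -/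
theorem doubleCosetOp_inv_eq (g : G) [Finite (MulAction.orbit K ((g : G) : G ⧸ K))]
    [Finite (MulAction.orbit K ((g⁻¹ : G) : G ⧸ K))]
    (hg : ((g⁻¹ : G) : G ⧸ K) ∈ MulAction.orbit K ((g : G) : G ⧸ K)) :
    T5HeckeDoubleCoset.doubleCosetOp k K g⁻¹ = T5HeckeDoubleCoset.doubleCosetOp k K g :=
  T5HeckeDoubleCoset.doubleCosetOp_eq_of_orbit_eq k K (MulAction.orbit_eq_iff.2 hg)

/-- **The Hecke operators are self-adjoint**: `B(T_g v, w) = B(v, T_g w)` for a `G`-invariant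
hermitian form `B`, `v, w ∈ π^K`, when `g⁻¹ ∈ K g K` (and `#(Kg⁻¹K/K) = #(KgK/K)`). -/
theorem apply_heckeSMul_doubleCosetOp_self (hK : ∀ g : G, Finite (MulAction.orbit K (g : G ⧸ K)))
    {B : V →ₗ⋆[k] V →ₗ[k] k} (hB : IsInvariantSesq ρ B) (hH : IsHermitian B) (g : G)
    (hg : ((g⁻¹ : G) : G ⧸ K) ∈ MulAction.orbit K ((g : G) : G ⧸ K))
    (hU : (MulAction.orbit K ((g⁻¹ : G) : G ⧸ K)).ncard = (MulAction.orbit K ((g : G) : G ⧸ K)).ncard)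
    (v w : invariants ρ K) :
    haveI := hK g
    B (heckeSMul ρ (T5HeckeDoubleCoset.doubleCosetOp k K g) v : V) (w : V) =
      B (v : V) (heckeSMul ρ (T5HeckeDoubleCoset.doubleCosetOp k K g) w : V) := by
  haveI := hK g; haveI := hK g⁻¹
  rw [apply_heckeSMul_doubleCosetOp_eq_apply_heckeSMul_doubleCosetOp_inv hK hB hH g hU v w,
    doubleCosetOp_inv_eq g hg]

/-- Under the double-coset condition for every `g`, `T^* = T̄` (the transpose is the identity), so
`B(T v, w) = B(v, T̄ w)` for every `T ∈ H(G, K)`. -/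
theorem apply_heckeSMul_eq_apply_heckeSMul_conjOp (hK : ∀ g : G, Finite (MulAction.orbit K (g : G ⧸ K)))
    (hU : ∀ g : G, (MulAction.orbit K ((g⁻¹ : G) : G ⧸ K)).ncard =
      (MulAction.orbit K ((g : G) : G ⧸ K)).ncard)
    (hinv : ∀ g : G, ((g⁻¹ : G) : G ⧸ K) ∈ MulAction.orbit K ((g : G) : G ⧸ K))
    {B : V →ₗ⋆[k] V →ₗ[k] k} (hB : IsInvariantSesq ρ B) (hH : IsHermitian B)
    (T : heckeAlgebra k K) (v w : invariants ρ K) :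
    B (heckeSMul ρ T v : V) (w : V) = B (v : V) (heckeSMul ρ (conjOp T) w : V) := by
  rw [apply_heckeSMul_eq_apply_heckeSMul_starOp hK hU hB hH T v w]
  have : starOp hK T = conjOp T := transposeOp_eq_self_of_inv_mem_orbit hK hinv (conjOp T)
  rw [this]

/-- For `T` with real (self-conjugate) coefficients, `T` is self-adjoint on `π^K`:
`B(T v, w) = B(v, T w)`. -/
theorem apply_heckeSMul_eq_apply_heckeSMul_of_conjOp_eq
    (hK : ∀ g : G, Finite (MulAction.orbit K (g : G ⧸ K)))
    (hU : ∀ g : G, (MulAction.orbit K ((g⁻¹ : G) : G ⧸ K)).ncard =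
      (MulAction.orbit K ((g : G) : G ⧸ K)).ncard)
    (hinv : ∀ g : G, ((g⁻¹ : G) : G ⧸ K) ∈ MulAction.orbit K ((g : G) : G ⧸ K))
    {B : V →ₗ⋆[k] V →ₗ[k] k} (hB : IsInvariantSesq ρ B) (hH : IsHermitian B)
    {T : heckeAlgebra k K} (hT : conjOp T = T) (v w : invariants ρ K) :
    B (heckeSMul ρ T v : V) (w : V) = B (v : V) (heckeSMul ρ T w : V) := by
  rw [apply_heckeSMul_eq_apply_heckeSMul_conjOp hK hU hinv hB hH T v w, hT]

end Summit.Ventures.HodgeRepro2.T5HeckeSelfAdjoint
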